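import Literature.NumberTheory.Weil1964.LocalLerayCocycle
import HarnessLib

/-!
# The Leray cocycle is a coboundary on the stabiliser of any Lagrangian

Topic `NumberTheory/Weil1964`; namespace `Literature.NumberTheory.Weil1964`.  KERNEL only (theorems, no named
fact, no `sorry`).  Sequel of `LocalLerayCocycle.lean`.

For a symplectic space `(V, B)` over a non-archimedean local field of characteristic `≠ 2`, a Lagrangian `ℓ` and
ANOTHER Lagrangian `m`, the chain ∕ cocycle identity of the Leray–Maslov–Weil index ([LionVergne1980, §1.5.8],
tree `lerayWeilIndex_cocycle`) applied to the four Lagrangians `ℓ, g₁ℓ, g₁g₂ℓ, m` and the `Sp`-invariance of the index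
(`lerayWeilIndex_map`) give, for isometries `g₁, g₂` FIXING `m`,

  `c_ℓ(g₁, g₂) · λ_m(g₁g₂) = λ_m(g₁) · λ_m(g₂)`,   `λ_m(g) := μ(ℓ, gℓ, m)`

(`lerayCocycle_mul_stabiliserFun`), i.e. **the Leray cocycle `c_ℓ` restricted to the stabiliser `Stab(m) ≤ Sp(B)` of
ANY Lagrangian `m` is the coboundary of the explicit unit-modulus function `λ_m`** (`lerayCentralCocycle_stabiliser`).
This is the form in which [LionVergne1980, §1.7] trivialise the Maslov cocycle on the stabiliser of a Lagrangian and
the mechanism behind the splitting of the metaplectic cover over a Siegel parabolic ([MoeglinVignerasWaldspurger1987,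
Chap. 2 II.7]; tree `isSplitting_lerayCentralCocycle_siegelParabolic` is the case `m = ℓ`); in the construction of
the compatible splitting over a unitary group ([Kudla1994, Thm 3.1]; [GelbartRogawski1991, §3.1 Prop. 3.1.1]) it
disposes of the SPLIT places (the unitary group then preserves a Lagrangian) and of the Siegel parabolic of the
doubled group.

## References

* G. Lion, M. Vergne, *The Weil representation, Maslov index and theta series*, Progress in Math. 6 (1980), §1.5.8,
  §1.7 [LionVergne1980].
* C. Mœglin, M.-F. Vignéras, J.-L. Waldspurger, LNM 1291 (1987), Chap. 2 II.7, Chap. 3 I.3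
  [MoeglinVignerasWaldspurger1987].
* S. S. Kudla, Israel J. Math. 87 (1994) 361–401, Thm 3.1 [Kudla1994].
-/

set_option autoImplicit false

noncomputable section

open MeasureTheory
open Literature.RepresentationTheory.HeisenbergGroup Literature.GroupTheory
open Literature.LinearAlgebra.QuadraticForm

namespace Literature.NumberTheory.Weil1964

variable {F : Type*} [Field F] [ValuativeRel F] [TopologicalSpace F] [IsNonarchimedeanLocalField F]
variable [MeasurableSpace F] [BorelSpace F] (μ : Measure F) [μ.IsAddHaarMeasure] {ψ : AddChar F Circle}
  [Invertible (2 : F)]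
variable {V : Type*} [AddCommGroup V] [Module F V] [FiniteDimensional F V]

omit [ValuativeRel F] [TopologicalSpace F] [IsNonarchimedeanLocalField F] [MeasurableSpace F] [BorelSpace F]
  [Invertible (2 : F)] [FiniteDimensional F V] in
/-- `(g h) ℓ = g (h ℓ)`. [folklore] -/
private theorem map_mul_eq' (ℓ : Submodule F V) (g h : V ≃ₗ[F] V) :
    ℓ.map ((g * h : V ≃ₗ[F] V) : V →ₗ[F] V) = (ℓ.map (h : V →ₗ[F] V)).map (g : V →ₗ[F] V) := by
  rw [LinearEquiv.coe_toLinearMap_mul, Module.End.mul_eq_comp, Submodule.map_comp]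

/-- **the stabiliser function `λ_m(g) = μ_ψ(ℓ, gℓ, m)`** of a second Lagrangian `m` (a unit-modulus complex number,
`norm_lerayWeilIndex`). [cite: LionVergne1980, §1.7] -/
def stabiliserFun (ψ : AddChar F Circle) (μ : Measure F) (B : LinearMap.BilinForm F V) (ℓ m : Submodule F V)
    (g : V ≃ₗ[F] V) : ℂ :=
  lerayWeilIndex ψ μ B ℓ (ℓ.map (g : V →ₗ[F] V)) m

omit [BorelSpace F] [μ.IsAddHaarMeasure] in
/-- unfolding. [cite: LionVergne1980, §1.7] -/
theorem stabiliserFun_def (B : LinearMap.BilinForm F V) (ℓ m : Submodule F V) (g : V ≃ₗ[F] V) :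
    stabiliserFun ψ μ B ℓ m g = lerayWeilIndex ψ μ B ℓ (ℓ.map (g : V →ₗ[F] V)) m := rfl

/-- `|λ_m(g)| = 1`. [cite: LionVergne1980, §1.7] -/
theorem norm_stabiliserFun (hψ : ψ.IsContinuousNontrivial) (B : LinearMap.BilinForm F V) (ℓ m : Submodule F V)
    (g : V ≃ₗ[F] V) : ‖stabiliserFun ψ μ B ℓ m g‖ = 1 :=
  norm_lerayWeilIndex μ hψ B _ _ _

/-- `λ_m(g) ≠ 0`. [cite: LionVergne1980, §1.7] -/
theorem stabiliserFun_ne_zero (hψ : ψ.IsContinuousNontrivial) (B : LinearMap.BilinForm F V) (ℓ m : Submodule F V)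
    (g : V ≃ₗ[F] V) : stabiliserFun ψ μ B ℓ m g ≠ 0 := by
  intro h
  have := norm_stabiliserFun μ hψ B ℓ m g
  rw [h, norm_zero] at this
  exact zero_ne_one this

/-- `λ_m(1) = μ(ℓ, ℓ, m) = 1`. [cite: LionVergne1980, §1.7] -/
theorem stabiliserFun_one (hψ : ψ.IsContinuousNontrivial) (B : LinearMap.BilinForm F V) {ℓ : Submodule F V}
    (hℓ : B.orthogonal ℓ = ℓ) (m : Submodule F V) : stabiliserFun ψ μ B ℓ m 1 = 1 := by
  rw [stabiliserFun, LinearEquiv.coe_toLinearMap_one, Submodule.map_id]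
  exact lerayWeilIndex_self₁₂ μ hψ B (isotropic_of_orthogonal_eq_self hℓ) m

/-- **THE STABILISER IDENTITY `c_ℓ(g₁, g₂) · λ_m(g₁g₂) = λ_m(g₁) · λ_m(g₂)`** for isometries `g₁, g₂` of the
symplectic space `(V, B)` FIXING the Lagrangian `m` (`m.map gᵢ = m`): the cocycle identity of the Leray index for
`ℓ, g₁ℓ, g₁g₂ℓ, m` (`lerayWeilIndex_cocycle`), in which the factor `μ(g₁ℓ, g₁g₂ℓ, m) = μ(g₁ℓ, g₁g₂ℓ, g₁m)` equals
`μ(ℓ, g₂ℓ, m) = λ_m(g₂)` by `g₁`-invariance and `conj μ(ℓ, g₁g₂ℓ, m) = λ_m(g₁g₂)⁻¹`.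
[cite: LionVergne1980, §1.5.8 with §1.7] -/
theorem lerayCocycle_mul_stabiliserFun (hψ : ψ.IsContinuousNontrivial) {B : LinearMap.BilinForm F V}
    (hB : LinearMap.IsAlt B) (hN : B.Nondegenerate) {ℓ m : Submodule F V} (hℓ : B.orthogonal ℓ = ℓ)
    (hm : B.orthogonal m = m) {g₁ g₂ : V ≃ₗ[F] V} (hg₁ : ∀ x y, B (g₁ x) (g₁ y) = B x y)
    (hg₂ : ∀ x y, B (g₂ x) (g₂ y) = B x y) (h₁ : m.map (g₁ : V →ₗ[F] V) = m) :
    lerayCocycle ψ μ B ℓ g₁ g₂ * stabiliserFun ψ μ B ℓ m (g₁ * g₂) =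
      stabiliserFun ψ μ B ℓ m g₁ * stabiliserFun ψ μ B ℓ m g₂ := by
  have hg₁₂ : ∀ x y, B ((g₁ * g₂) x) ((g₁ * g₂) y) = B x y := fun x y => by
    simp only [LinearEquiv.mul_apply, hg₁, hg₂]
  have L₂ := orthogonal_map_eq_self hN hℓ g₁ hg₁
  have L₃ := orthogonal_map_eq_self hN hℓ (g₁ * g₂) hg₁₂
  -- cocycle identity for `ℓ, g₁ℓ, g₁g₂ℓ, m`:
  -- `μ(g₁ℓ, g₁g₂ℓ, m) · conj μ(ℓ, g₁g₂ℓ, m) · μ(ℓ, g₁ℓ, m) = μ(ℓ, g₁ℓ, g₁g₂ℓ) = c(g₁, g₂)`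
  have hc := lerayWeilIndex_cocycle μ hψ hB hN hℓ L₂ L₃ hm
  -- `μ(g₁ℓ, g₁g₂ℓ, m) = μ(g₁ℓ, g₁(g₂ℓ), g₁m) = μ(ℓ, g₂ℓ, m)`
  have hmid : lerayWeilIndex ψ μ B (ℓ.map (g₁ : V →ₗ[F] V)) (ℓ.map ((g₁ * g₂ : V ≃ₗ[F] V) : V →ₗ[F] V)) m =
      stabiliserFun ψ μ B ℓ m g₂ := by
    conv_lhs => rw [← h₁, map_mul_eq' ℓ g₁ g₂]
    rw [lerayWeilIndex_map μ hψ B g₁ hg₁, stabiliserFun]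
  have hconj : stabiliserFun ψ μ B ℓ m (g₁ * g₂) *
      (starRingEnd ℂ) (lerayWeilIndex ψ μ B ℓ (ℓ.map ((g₁ * g₂ : V ≃ₗ[F] V) : V →ₗ[F] V)) m) = 1 :=
    lerayWeilIndex_mul_conj μ hψ B _ _ _
  rw [lerayCocycle_def, ← hc, hmid,
    show lerayWeilIndex ψ μ B ℓ (ℓ.map (g₁ : V →ₗ[F] V)) m = stabiliserFun ψ μ B ℓ m g₁ from rfl]
  -- goal: `λ(g₂) · conj μ(ℓ,g₁g₂ℓ,m) · λ(g₁) · λ(g₁g₂) = λ(g₁) λ(g₂)`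
  linear_combination (stabiliserFun ψ μ B ℓ m g₂ * stabiliserFun ψ μ B ℓ m g₁) * hconj

/-- the same, solved for the cocycle: `c_ℓ(g₁, g₂) = λ_m(g₁) λ_m(g₂) λ_m(g₁g₂)⁻¹`. [cite: LionVergne1980, §1.7] -/
theorem lerayCocycle_eq_stabiliserFun (hψ : ψ.IsContinuousNontrivial) {B : LinearMap.BilinForm F V}
    (hB : LinearMap.IsAlt B) (hN : B.Nondegenerate) {ℓ m : Submodule F V} (hℓ : B.orthogonal ℓ = ℓ)
    (hm : B.orthogonal m = m) {g₁ g₂ : V ≃ₗ[F] V} (hg₁ : ∀ x y, B (g₁ x) (g₁ y) = B x y)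
    (hg₂ : ∀ x y, B (g₂ x) (g₂ y) = B x y) (h₁ : m.map (g₁ : V →ₗ[F] V) = m) :
    lerayCocycle ψ μ B ℓ g₁ g₂ =
      stabiliserFun ψ μ B ℓ m g₁ * stabiliserFun ψ μ B ℓ m g₂ * (stabiliserFun ψ μ B ℓ m (g₁ * g₂))⁻¹ := by
  rw [← lerayCocycle_mul_stabiliserFun μ hψ hB hN hℓ hm hg₁ hg₂ h₁,
    mul_inv_cancel_right₀ (stabiliserFun_ne_zero μ hψ B ℓ m _)]

/-! ## Bundled form: the Leray extension splits over the stabiliser of a Lagrangian -/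

/-- the stabiliser function as a unit, on the isometry group. [cite: LionVergne1980, §1.7] -/
def stabiliserUnit (hψ : ψ.IsContinuousNontrivial) (B : LinearMap.BilinForm F V) (ℓ m : Submodule F V)
    (g : Heisenberg.PseudoSymplectic.isometries B) : ℂˣ :=
  Units.mk0 (stabiliserFun ψ μ B ℓ m g.1) (stabiliserFun_ne_zero μ hψ B ℓ m g.1)

/-- its value. [cite: LionVergne1980, §1.7] -/
@[simp] theorem coe_stabiliserUnit (hψ : ψ.IsContinuousNontrivial) (B : LinearMap.BilinForm F V)
    (ℓ m : Submodule F V) (g : Heisenberg.PseudoSymplectic.isometries B) :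
    ((stabiliserUnit μ hψ B ℓ m g : ℂˣ) : ℂ) = stabiliserFun ψ μ B ℓ m g.1 := rfl

/-- **the Leray central cocycle restricted to isometries fixing a Lagrangian `m` is the coboundary of `λ_m`**:
`c_ℓ(g₁, g₂) · λ_m(g₁g₂) = λ_m(g₁) λ_m(g₂)` in `ℂˣ`, for `g₁ m = m` (no condition on `g₂` is needed).
[cite: LionVergne1980, §1.7; MoeglinVignerasWaldspurger1987, Chap. 2 II.7] -/
theorem lerayCentralCocycle_stabiliser (hψ : ψ.IsContinuousNontrivial) {B : LinearMap.BilinForm F V}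
    (hB : LinearMap.IsAlt B) (hN : B.Nondegenerate) {ℓ m : Submodule F V} (hℓ : B.orthogonal ℓ = ℓ)
    (hm : B.orthogonal m = m) (g₁ g₂ : Heisenberg.PseudoSymplectic.isometries B)
    (h₁ : m.map ((g₁ : V ≃ₗ[F] V) : V →ₗ[F] V) = m) :
    lerayCentralCocycle μ hψ hB hN hℓ g₁ g₂ * stabiliserUnit μ hψ B ℓ m (g₁ * g₂) =
      stabiliserUnit μ hψ B ℓ m g₁ * stabiliserUnit μ hψ B ℓ m g₂ := by
  ext
  simp only [Units.val_mul, lerayCentralCocycle_apply, coe_stabiliserUnit, Subgroup.coe_mul]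
  exact lerayCocycle_mul_stabiliserFun μ hψ hB hN hℓ hm
    ((Heisenberg.PseudoSymplectic.mem_isometries B _).1 g₁.2)
    ((Heisenberg.PseudoSymplectic.mem_isometries B _).1 g₂.2) h₁

/-- **the section `g ↦ (g, λ_m(g)⁻¹)` of the Leray extension `Sp(B) ×_c ℂˣ` is MULTIPLICATIVE on pairs whose first
member fixes `m`** — so the metaplectic-type extension defined by `c_ℓ` splits, explicitly, over the stabiliser of
any Lagrangian (the split places and the Siegel parabolic of the doubled group in [Kudla1994, Thm 3.1]).
[cite: MoeglinVignerasWaldspurger1987, Chap. 2 II.7; Kudla1994, Thm 3.1] -/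
theorem sec_stabiliser_mul (hψ : ψ.IsContinuousNontrivial) {B : LinearMap.BilinForm F V}
    (hB : LinearMap.IsAlt B) (hN : B.Nondegenerate) {ℓ m : Submodule F V} (hℓ : B.orthogonal ℓ = ℓ)
    (hm : B.orthogonal m = m) (g₁ g₂ : Heisenberg.PseudoSymplectic.isometries B)
    (h₁ : m.map ((g₁ : V ≃ₗ[F] V) : V →ₗ[F] V) = m) :
    (TwistedProduct.inl (lerayCentralCocycle μ hψ hB hN hℓ) (stabiliserUnit μ hψ B ℓ m g₁)⁻¹ *
        TwistedProduct.sec _ g₁) *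
      (TwistedProduct.inl _ (stabiliserUnit μ hψ B ℓ m g₂)⁻¹ *
        TwistedProduct.sec _ g₂) =
      TwistedProduct.inl _ (stabiliserUnit μ hψ B ℓ m (g₁ * g₂))⁻¹ *
        TwistedProduct.sec _ (g₁ * g₂) := by
  have h := lerayCentralCocycle_stabiliser μ hψ hB hN hℓ hm g₁ g₂ h₁
  have ha : (stabiliserUnit μ hψ B ℓ m (g₁ * g₂))⁻¹ =
      (stabiliserUnit μ hψ B ℓ m g₁)⁻¹ * (stabiliserUnit μ hψ B ℓ m g₂)⁻¹ *
        lerayCentralCocycle μ hψ hB hN hℓ g₁ g₂ := by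
    rw [eq_inv_mul_of_mul_eq h, mul_inv_rev, inv_inv, mul_inv_rev, mul_comm (stabiliserUnit μ hψ B ℓ m g₂)⁻¹]
  rw [TwistedProduct.inl_mul_sec, TwistedProduct.inl_mul_sec, TwistedProduct.inl_mul_sec, ha]
  rfl

end Literature.NumberTheory.Weil1964

end
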